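import Summits.CriticalPhenomena.PercolationContinuityZ3.Theorems.PercNearOneGluingNoHeavyLowerTailIncStarBlocks
import Summits.CriticalPhenomena.PercolationContinuityZ3.Theorems.PercNearOneGluingNoHeavyLowerTailSahiTwoChainUnions
import Summits.CriticalPhenomena.PercolationContinuityZ3.Theorems.PercNearOneGluingNoHeavyLowerTailIncStarCycle
import Literature.Probability.Percolation.DiagonalStripColumns
import Literature.Probability.Percolation.BlockExplorationBasic
import Literature.Probability.Percolation.AnchoredIsoperimetricProfileProofs
import HarnessLib

/-!
# The increasing star is a BLOCK property: the cut-vertex composition theorem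

Support file for the Sahi programme (`--supports stmt-CriticalPhenomena-4575`, prover prim-sahi-p2 gen 8).
No definitions, no named facts, no sorries; standard axioms.  Memo `…/prim-sahi-p2/PROOF-E3.md` §19(f).

**Setting.**  A finite vertex type `V` with weights `w : Sym2 V → [0,1]` (product Bernoulli bond percolation on
all pairs), two vertex sets `V₁, V₂` meeting exactly in the CUT VERTEX `a`, no edge of positive weight between
`V₁ ∖ {a}` and `V₂ ∖ {a}`, and a root `s ∈ V₁`.  Connection events are taken inside `V₁ ∪ V₂`
(`openConnIn (V₁ ∪ V₂) s t`), so that the theorem composes along the block–cut tree.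

**Theorem `incStar_openConnIn_of_cutVertex`.**  If the increasing star holds for the root-connection events of
`(V₁, s)` and for those of `(V₂, a)` — `0 ≤ E₃({s ↔_{V₁} x}, {s ↔_{V₁} y}, {s ↔_{V₁} z})` for all `x y z ∈ V₁` and
`0 ≤ E₃({a ↔_{V₂} x}, …)` for all `x y z ∈ V₂` — then it holds for `(V₁ ∪ V₂, s)`:
`0 ≤ E₃({s ↔_{V₁∪V₂} t₁}, {s ↔_{V₁∪V₂} t₂}, {s ↔_{V₁∪V₂} t₃})` for all `t₁ t₂ t₃ ∈ V₁ ∪ V₂`.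
(`incStar_of_cutVertex`: the same with `V₁ ∪ V₂ = univ` and the plain events `openConn s t`.)

**Proof.**  On configurations of positive weight no pair between `V₁∖a` and `V₂∖a` is open, hence (last-exit
decomposition `exists_lastExit_of_openConnIn`) `{s ↔ t} = {s ↔_{V₁} a} ∩ {a ↔_{V₂} t}` for `t ∈ V₂` and
`{s ↔ t} = {s ↔_{V₁} t}` for `t ∈ V₁`; the `V₁`-events are determined by the off-diagonal pairs inside `V₁`, the
`V₂`-events by those inside `V₂`, disjoint sets of coordinates.  `E₃` only sees product moments
(`TwoChainUnions.sahiE_congr_of_prodMoments`), and the series-composition lemmas of `…IncStarBlocks.lean` finish: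
no target beyond `a` — hypothesis on `V₁`; one — `sahiE3_inter_scale`; two — `sahiE3_commonFactor_two_nonneg`
(Harris only); three — `sahiE3_commonFactor_three_nonneg` with the hypothesis on `(V₂, a)`.
Consequence (memo §19f): the increasing star holds on every graph all of whose blocks satisfy it, e.g. every
cactus graph (`…IncStarCycle*.lean` for the cycle blocks, in absolute form).
-/

noncomputable section

namespace Summit.CriticalPhenomena.PercolationContinuityZ3.Theorems

namespace IncStarCutVertex

open Finset MeasureTheory Literature.Combinatorics.Sahi2008 Literature.Probability.Percolation
  Literature.Probability.LatticeModels
open Literature.Probability.Percolation.DecisionTree (ind ind_of_mem ind_of_not_mem ind_nonneg)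
open Literature.Probability.Percolation.BHK2006 (weight)
open Literature.Probability.Percolation.BlockExploration (exists_openWalk_of_mem_openConnIn
  mem_openConn_iff_openConnIn_univ)
open scoped Classical

variable {V : Type*}

/-! ### `openConnIn` plumbing -/

/-- **`{x ↔ y in S}` is determined by the off-diagonal pairs inside `S`.** [folklore] -/
theorem determinedBy_openConnIn_offDiag (S : Set V) (x y : V) :
    DeterminedBy (openConnIn S x y : Set (BondConfig V)) {z : Sym2 V | ¬ z.IsDiag ∧ ∀ v ∈ z, v ∈ S} := by
  rw [determinedBy_iff]
  suffices key : ∀ ω ω' : BondConfig V, ω ∩ {z : Sym2 V | ¬ z.IsDiag ∧ ∀ v ∈ z, v ∈ S} =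
      ω' ∩ {z : Sym2 V | ¬ z.IsDiag ∧ ∀ v ∈ z, v ∈ S} → ω ∈ openConnIn S x y → ω' ∈ openConnIn S x y by
    intro ω ω' h
    exact ⟨key ω ω' h, key ω' ω h.symm⟩
  intro ω ω' h hω
  obtain ⟨p, hp⟩ := exists_openWalk_of_mem_openConnIn hω
  have hedges : ∀ e, e ∈ p.edges → e ∈ (openGraph ω').edgeSet := by
    intro e he
    have heG : e ∈ (openGraph ω).edgeSet := p.edges_subset_edgeSet he
    revert heG he
    refine Sym2.inductionOn e fun u v => ?_
    intro he heG
    rw [SimpleGraph.mem_edgeSet, openGraph_adj] at heG ⊢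
    have hu : u ∈ S := hp u (p.fst_mem_support_of_mem_edges he)
    have hv : v ∈ S := hp v (p.snd_mem_support_of_mem_edges he)
    have hmemF : s(u, v) ∈ {z : Sym2 V | ¬ z.IsDiag ∧ ∀ v ∈ z, v ∈ S} := by
      refine ⟨by rw [Sym2.mk_isDiag_iff]; exact heG.2, fun t ht => ?_⟩
      rcases Sym2.mem_iff.1 ht with rfl | rfl
      · exact hu
      · exact hv
    exact ⟨((Set.ext_iff.1 h (s(u, v))).1 ⟨heG.1, hmemF⟩).1, heG.2⟩
  refine mem_openConnIn_of_openWalk (p.transfer (openGraph ω') hedges) fun z hz => ?_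
  rw [SimpleGraph.Walk.support_transfer] at hz
  exact hp z hz

/-! ### Deterministic structure at a cut vertex -/

section CutVertex

variable {V₁ V₂ : Set V} {a : V} (hV : ∀ x, x ∈ V₁ → x ∈ V₂ → x = a) (ha₁ : a ∈ V₁) (ha₂ : a ∈ V₂)
  {ω : BondConfig V} (hω : ∀ x y : V, x ∈ V₁ → y ∈ V₂ → x ≠ a → y ≠ a → s(x, y) ∉ ω)

include hV ha₁ ha₂ hω

/-- If `s ∈ V₁` is joined to the cut vertex inside `V₁ ∪ V₂` then already inside `V₁`. [this work] -/
theorem openConnIn_left_of_union {s : V} (hs : s ∈ V₁) (h : ω ∈ openConnIn (V₁ ∪ V₂) s a) :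
    ω ∈ openConnIn V₁ s a := by
  have hU : V₁ ∪ (V₂ \ {a}) = V₁ ∪ V₂ := by
    ext x
    simp only [Set.mem_union, Set.mem_sdiff, Set.mem_singleton_iff]
    constructor
    · rintro (hx | ⟨hx, -⟩); exacts [Or.inl hx, Or.inr hx]
    · rintro (hx | hx)
      · exact Or.inl hx
      · by_cases hxa : x = a
        · exact Or.inl (hxa ▸ ha₁)
        · exact Or.inr ⟨hx, hxa⟩
  have h' : ω ∈ openConnIn (V₁ ∪ (V₂ \ {a})) a s := by rw [hU]; exact openConnIn_symm' h
  have hH : ∀ u ∈ V₂ \ {a}, ∀ v ∈ V₁, (openGraph ω).Adj u v → v ∈ ({a} : Set V) := by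
    intro u hu v hv hadj
    by_contra hva
    rw [openGraph_adj] at hadj
    have := hω v u hv hu.1 hva hu.2
    rw [Sym2.eq_swap] at this
    exact this hadj.1
  obtain ⟨f, hf, -, h2⟩ := exists_lastExit_of_openConnIn hH hs h'
  have hfa : f = a := by rcases hf with hf | hf; exacts [hf, hf]
  subst hfa
  exact openConnIn_symm' h2

/-- **Targets beyond the cut vertex**: for `s ∈ V₁`, `t ∈ V₂`,
`{s ↔ t in V₁ ∪ V₂} = {s ↔ a in V₁} ∩ {a ↔ t in V₂}`. [this work] -/
theorem openConnIn_union_iff_of_mem_right {s t : V} (hs : s ∈ V₁) (ht : t ∈ V₂) :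
    ω ∈ openConnIn (V₁ ∪ V₂) s t ↔ ω ∈ openConnIn V₁ s a ∧ ω ∈ openConnIn V₂ a t := by
  constructor
  · intro h
    have hU : V₂ ∪ (V₁ \ {a}) = V₁ ∪ V₂ := by
      ext x
      simp only [Set.mem_union, Set.mem_sdiff, Set.mem_singleton_iff]
      constructor
      · rintro (hx | ⟨hx, -⟩); exacts [Or.inr hx, Or.inl hx]
      · rintro (hx | hx)
        · by_cases hxa : x = a
          · exact Or.inl (hxa ▸ ha₂)
          · exact Or.inr ⟨hx, hxa⟩
        · exact Or.inl hx
    have h' : ω ∈ openConnIn (V₂ ∪ (V₁ \ {a})) s t := by rw [hU]; exact h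
    have hH : ∀ u ∈ V₁ \ {a}, ∀ v ∈ V₂, (openGraph ω).Adj u v → v ∈ ({a} : Set V) := by
      intro u hu v hv hadj
      by_contra hva
      rw [openGraph_adj] at hadj
      exact hω u v hu.1 hv hu.2 hva hadj.1
    obtain ⟨f, hf, h1, h2⟩ := exists_lastExit_of_openConnIn hH ht h'
    rcases hf with hf | hf
    · -- last exit at `a`
      rw [Set.mem_singleton_iff] at hf
      subst hf
      rw [hU] at h1
      exact ⟨openConnIn_left_of_union hV ha₁ ha₂ hω hs h1, h2⟩
    · -- the path never left `V₂`: then `s ∈ V₂`, so `s = a`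
      subst hf
      have hsa : f = a := hV f hs h2.1
      subst hsa
      exact ⟨⟨ha₁, ha₁, SimpleGraph.Reachable.refl _⟩, h2⟩
  · rintro ⟨h1, h2⟩
    exact PlanarDuality.openConnIn_trans (openConnIn_mono Set.subset_union_left _ _ h1)
      (openConnIn_mono Set.subset_union_right _ _ h2)

/-- **Targets on the near side**: for `s, t ∈ V₁`, `{s ↔ t in V₁ ∪ V₂} = {s ↔ t in V₁}`. [this work] -/
theorem openConnIn_union_iff_of_mem_left {s t : V} (hs : s ∈ V₁) (ht : t ∈ V₁) :
    ω ∈ openConnIn (V₁ ∪ V₂) s t ↔ ω ∈ openConnIn V₁ s t := by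
  constructor
  · intro h
    have hU : V₁ ∪ (V₂ \ {a}) = V₁ ∪ V₂ := by
      ext x
      simp only [Set.mem_union, Set.mem_sdiff, Set.mem_singleton_iff]
      constructor
      · rintro (hx | ⟨hx, -⟩); exacts [Or.inl hx, Or.inr hx]
      · rintro (hx | hx)
        · exact Or.inl hx
        · by_cases hxa : x = a
          · exact Or.inl (hxa ▸ ha₁)
          · exact Or.inr ⟨hx, hxa⟩
    have h' : ω ∈ openConnIn (V₁ ∪ (V₂ \ {a})) s t := by rw [hU]; exact h
    have hH : ∀ u ∈ V₂ \ {a}, ∀ v ∈ V₁, (openGraph ω).Adj u v → v ∈ ({a} : Set V) := by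
      intro u hu v hv hadj
      by_contra hva
      rw [openGraph_adj] at hadj
      have := hω v u hv hu.1 hva hu.2
      rw [Sym2.eq_swap] at this
      exact this hadj.1
    obtain ⟨f, hf, h1, h2⟩ := exists_lastExit_of_openConnIn hH ht h'
    rcases hf with hf | hf
    · rw [Set.mem_singleton_iff] at hf
      subst hf
      rw [hU] at h1
      exact PlanarDuality.openConnIn_trans (openConnIn_left_of_union hV ha₁ ha₂ hω hs h1) h2
    · subst hf; exact h2
  · exact fun h => openConnIn_mono Set.subset_union_left _ _ h

end CutVertex

/-! ### The composition theorem -/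

variable [Fintype V]

/-- **The increasing star passes through a cut vertex (relative form).**  Let `V₁ ∩ V₂ = {a}`, `s ∈ V₁`, and let
`w` vanish on the pairs between `V₁ ∖ {a}` and `V₂ ∖ {a}`.  If `E₃ ≥ 0` for all triples of root-connection events
of `(V₁, s)` inside `V₁` and of `(V₂, a)` inside `V₂`, then `E₃ ≥ 0` for all triples of root-connection events of
`(V₁ ∪ V₂, s)` inside `V₁ ∪ V₂`. [this work] -/
theorem incStar_openConnIn_of_cutVertex (w : Sym2 V → unitInterval) {V₁ V₂ : Set V} {a s : V}
    (hV : ∀ x, x ∈ V₁ → x ∈ V₂ → x = a) (ha₁ : a ∈ V₁) (ha₂ : a ∈ V₂) (hs : s ∈ V₁)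
    (hw : ∀ x y : V, x ∈ V₁ → y ∈ V₂ → x ≠ a → y ≠ a → w s(x, y) = 0)
    (h₁ : ∀ x y z : V, x ∈ V₁ → y ∈ V₁ → z ∈ V₁ →
      0 ≤ sahiE3 (prodBernoulli w) (openConnIn V₁ s x) (openConnIn V₁ s y) (openConnIn V₁ s z))
    (h₂ : ∀ x y z : V, x ∈ V₂ → y ∈ V₂ → z ∈ V₂ →
      0 ≤ sahiE3 (prodBernoulli w) (openConnIn V₂ a x) (openConnIn V₂ a y) (openConnIn V₂ a z))
    {t₁ t₂ t₃ : V} (ht₁ : t₁ ∈ V₁ ∪ V₂) (ht₂ : t₂ ∈ V₁ ∪ V₂) (ht₃ : t₃ ∈ V₁ ∪ V₂) :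
    0 ≤ sahiE3 (prodBernoulli w) (openConnIn (V₁ ∪ V₂) s t₁) (openConnIn (V₁ ∪ V₂) s t₂)
      (openConnIn (V₁ ∪ V₂) s t₃) := by
  -- the factored events
  let D : Set (BondConfig V) := openConnIn V₁ s a
  let E' : V → Set (BondConfig V) := fun t => if t ∈ V₁ then openConnIn V₁ s t else D ∩ openConnIn V₂ a t
  -- (1) on positive-weight configurations the events agree with their factored forms
  have hagree : ∀ ω : BondConfig V, bernoulliWeight w ω ≠ 0 → ∀ t ∈ V₁ ∪ V₂,
      (ω ∈ openConnIn (V₁ ∪ V₂) s t ↔ ω ∈ E' t) := by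
    intro ω hωw t ht
    have hω : ∀ x y : V, x ∈ V₁ → y ∈ V₂ → x ≠ a → y ≠ a → s(x, y) ∉ ω :=
      fun x y hx hy hxa hya hmem => hωw (IncStarCycle.bernoulliWeight_eq_zero_of_mem w hmem (hw x y hx hy hxa hya))
    by_cases htV : t ∈ V₁
    · simp only [E', if_pos htV]
      exact openConnIn_union_iff_of_mem_left hV ha₁ ha₂ hω hs htV
    · simp only [E', if_neg htV, Set.mem_inter_iff]
      have ht₂ : t ∈ V₂ := by rcases ht with ht | ht; exacts [absurd ht htV, ht]
      exact openConnIn_union_iff_of_mem_right hV ha₁ ha₂ hω hs ht₂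
  -- (2) hence the two `E₃` agree
  have hmom : sahiE3 (prodBernoulli w) (openConnIn (V₁ ∪ V₂) s t₁) (openConnIn (V₁ ∪ V₂) s t₂)
      (openConnIn (V₁ ∪ V₂) s t₃) = sahiE3 (prodBernoulli w) (E' t₁) (E' t₂) (E' t₃) := by
    rw [← sahiE_three_ind, ← sahiE_three_ind]
    have hf : (![ind (openConnIn (V₁ ∪ V₂) s t₁), ind (openConnIn (V₁ ∪ V₂) s t₂),
        ind (openConnIn (V₁ ∪ V₂) s t₃)] : Fin 3 → BondConfig V → ℝ) =
        fun i => ind (openConnIn (V₁ ∪ V₂) s ((![t₁, t₂, t₃] : Fin 3 → V) i)) := by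
      funext i; fin_cases i <;> rfl
    have hf' : (![ind (E' t₁), ind (E' t₂), ind (E' t₃)] : Fin 3 → BondConfig V → ℝ) =
        fun i => ind (E' ((![t₁, t₂, t₃] : Fin 3 → V) i)) := by
      funext i; fin_cases i <;> rfl
    rw [hf, hf']
    have hti : ∀ i : Fin 3, (![t₁, t₂, t₃] : Fin 3 → V) i ∈ V₁ ∪ V₂ := by
      intro i; fin_cases i; exacts [ht₁, ht₂, ht₃]
    refine TwoChainUnions.sahiE_congr_of_prodMoments (bernoulliWeight w) (bernoulliWeight w) 3 _ _ fun S => ?_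
    rw [ex_def, ex_def]
    refine Finset.sum_congr rfl fun ω _ => ?_
    by_cases hωw : bernoulliWeight w ω = 0
    · rw [hωw, zero_mul, zero_mul]
    · congr 1
      rw [Finset.prod_apply, Finset.prod_apply]
      refine Finset.prod_congr rfl fun i _ => ?_
      by_cases h : ω ∈ openConnIn (V₁ ∪ V₂) s ((![t₁, t₂, t₃] : Fin 3 → V) i)
      · rw [ind_of_mem h, ind_of_mem ((hagree ω hωw _ (hti i)).1 h)]
      · rw [ind_of_not_mem h, ind_of_not_mem (fun h' => h ((hagree ω hωw _ (hti i)).2 h'))]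
  rw [hmom]
  -- (3) coordinates: off-diagonal pairs inside `V₁`
  set F : Finset (Sym2 V) := Finset.univ.filter fun z : Sym2 V => ¬ z.IsDiag ∧ ∀ v ∈ z, v ∈ V₁ with hF
  have hFcoe : (↑F : Set (Sym2 V)) = {z : Sym2 V | ¬ z.IsDiag ∧ ∀ v ∈ z, v ∈ V₁} := by
    ext z; simp [hF]
  have hdet₁ : ∀ x : V, DeterminedBy (openConnIn V₁ s x : Set (BondConfig V)) (↑F : Set (Sym2 V)) := by
    intro x; rw [hFcoe]; exact determinedBy_openConnIn_offDiag V₁ s x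
  have hdet₂ : ∀ x : V, DeterminedBy (openConnIn V₂ a x : Set (BondConfig V)) (↑F : Set (Sym2 V))ᶜ := by
    intro x
    refine (determinedBy_openConnIn_offDiag V₂ a x).mono fun z hz hzF => ?_
    rw [hFcoe] at hzF
    -- an off-diagonal pair inside both `V₁` and `V₂` would be the loop at `a`
    obtain ⟨hnd, hz₂⟩ := hz
    obtain ⟨-, hz₁⟩ := hzF
    revert hnd hz₁ hz₂
    refine Sym2.inductionOn z fun u v => ?_
    intro hnd hz₂ hz₁
    have hu : u = a := hV u (hz₁ u (Sym2.mem_mk_left u v)) (hz₂ u (Sym2.mem_mk_left u v))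
    have hv : v = a := hV v (hz₁ v (Sym2.mem_mk_right u v)) (hz₂ v (Sym2.mem_mk_right u v))
    exact hnd (by rw [Sym2.mk_isDiag_iff, hu, hv])
  have hm : ∀ X : Set (BondConfig V), MeasurableSet X := fun _ => MeasurableSet.of_discrete
  -- Harris inequalities used below
  have hHarris : ∀ {A B : Set (BondConfig V)}, IsUpperSet A → IsUpperSet B →
      (prodBernoulli w).real A * (prodBernoulli w).real B ≤ (prodBernoulli w).real (A ∩ B) :=
    fun hA hB => prodBernoulli_harris w hA hB (hm _) (hm _)
  have hup : ∀ (S : Set V) (x y : V), IsUpperSet (openConnIn S x y : Set (BondConfig V)) :=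
    fun S x y => isUpperSet_openConnIn S x y
  -- (4) the four sorted cases (targets beyond `a` first), then the symmetry of `E₃`
  have mem₂ : ∀ {u : V}, u ∈ V₁ ∪ V₂ → u ∉ V₁ → u ∈ V₂ := by
    intro u hu huV; rcases hu with hu | hu; exacts [absurd hu huV, hu]
  have hFc : ((↑(Fᶜ) : Set (Sym2 V))) = (↑F : Set (Sym2 V))ᶜ := Finset.coe_compl F
  have key : ∀ u₁ u₂ u₃ : V, u₁ ∈ V₁ ∪ V₂ → u₂ ∈ V₁ ∪ V₂ → u₃ ∈ V₁ ∪ V₂ →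
      (u₁ ∈ V₁ → u₂ ∈ V₁) → (u₂ ∈ V₁ → u₃ ∈ V₁) →
      0 ≤ sahiE3 (prodBernoulli w) (E' u₁) (E' u₂) (E' u₃) := by
    intro u₁ u₂ u₃ hu₁ hu₂ hu₃ h12 h23
    by_cases c₁ : u₁ ∈ V₁
    · -- no target beyond `a`
      have c₂ := h12 c₁; have c₃ := h23 c₂
      simp only [E', if_pos c₁, if_pos c₂, if_pos c₃]
      exact h₁ u₁ u₂ u₃ c₁ c₂ c₃
    by_cases c₂ : u₂ ∈ V₁
    · -- exactly `u₁` beyond: split off the independent far factor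
      have c₃ := h23 c₂
      simp only [E', if_neg c₁, if_pos c₂, if_pos c₃]
      have hscale := IncStarBlocks.sahiE3_inter_scale w Fᶜ (B := openConnIn V₂ a u₁) (D := D)
        (G₂ := openConnIn V₁ s u₂) (G₃ := openConnIn V₁ s u₃)
        (by rw [hFc]; exact hdet₂ u₁) (by rw [hFc, compl_compl]; exact hdet₁ a)
        (by rw [hFc, compl_compl]; exact hdet₁ u₂) (by rw [hFc, compl_compl]; exact hdet₁ u₃)
        (hm _) (hm _) (hm _) (hm _)
      rw [hscale]
      exact mul_nonneg measureReal_nonneg (h₁ a u₂ u₃ ha₁ c₂ c₃)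
    by_cases c₃ : u₃ ∈ V₁
    · -- `u₁, u₂` beyond, `u₃` near: Harris on both sides
      simp only [E', if_neg c₁, if_neg c₂, if_pos c₃]
      exact IncStarBlocks.sahiE3_commonFactor_two_nonneg w F (D := D) (G := openConnIn V₁ s u₃)
        (H₁ := openConnIn V₂ a u₁) (H₂ := openConnIn V₂ a u₂) (hdet₁ a) (hdet₁ u₃) (hdet₂ u₁) (hdet₂ u₂)
        (hm _) (hm _) (hm _) (hm _) (hHarris (hup _ _ _) (hup _ _ _)) (hHarris (hup _ _ _) (hup _ _ _))
    · -- all three beyond: the hypothesis on `(V₂, a)`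
      simp only [E', if_neg c₁, if_neg c₂, if_neg c₃]
      exact IncStarBlocks.sahiE3_commonFactor_three_nonneg w F (D := D) (H₁ := openConnIn V₂ a u₁)
        (H₂ := openConnIn V₂ a u₂) (H₃ := openConnIn V₂ a u₃) (hdet₁ a) (hdet₂ u₁) (hdet₂ u₂) (hdet₂ u₃)
        (hm _) (hm _) (hm _) (hm _) (hHarris (hup _ _ _) (hup _ _ _)) (hHarris (hup _ _ _) (hup _ _ _))
        (hHarris (hup _ _ _) (hup _ _ _)) (h₂ u₁ u₂ u₃ (mem₂ hu₁ c₁) (mem₂ hu₂ c₂) (mem₂ hu₃ c₃))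
  -- (5) sort the targets using the symmetry of `E₃`
  by_cases b₁ : t₁ ∈ V₁ <;> by_cases b₂ : t₂ ∈ V₁ <;> by_cases b₃ : t₃ ∈ V₁
  · exact key t₁ t₂ t₃ ht₁ ht₂ ht₃ (fun _ => b₂) (fun _ => b₃)
  · -- (N,N,B) → (B,N,N)
    rw [sahiE3_comm₂₃, sahiE3_comm₁₂]
    exact key t₃ t₁ t₂ ht₃ ht₁ ht₂ (fun h => absurd h b₃) (fun _ => b₂)
  · -- (N,B,N) → (B,N,N)
    rw [sahiE3_comm₁₂]
    exact key t₂ t₁ t₃ ht₂ ht₁ ht₃ (fun h => absurd h b₂) (fun _ => b₃)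
  · -- (N,B,B) → (B,B,N)
    rw [sahiE3_comm₁₂, sahiE3_comm₂₃]
    exact key t₂ t₃ t₁ ht₂ ht₃ ht₁ (fun h => absurd h b₂) (fun h => absurd h b₃)
  · -- (B,N,N)
    exact key t₁ t₂ t₃ ht₁ ht₂ ht₃ (fun h => absurd h b₁) (fun _ => b₃)
  · -- (B,N,B) → (B,B,N)
    rw [sahiE3_comm₂₃]
    exact key t₁ t₃ t₂ ht₁ ht₃ ht₂ (fun h => absurd h b₁) (fun h => absurd h b₃)
  · -- (B,B,N)
    exact key t₁ t₂ t₃ ht₁ ht₂ ht₃ (fun h => absurd h b₁) (fun h => absurd h b₂)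
  · -- (B,B,B)
    exact key t₁ t₂ t₃ ht₁ ht₂ ht₃ (fun h => absurd h b₁) (fun h => absurd h b₂)

/-- **The increasing star passes through a cut vertex (absolute form).**  If `V₁ ∪ V₂` is everything, the
conclusion is about the plain connection events `{s ↔ t}`. [this work] -/
theorem incStar_of_cutVertex (w : Sym2 V → unitInterval) {V₁ V₂ : Set V} {a s : V}
    (hV : ∀ x, x ∈ V₁ → x ∈ V₂ → x = a) (ha₁ : a ∈ V₁) (ha₂ : a ∈ V₂) (hs : s ∈ V₁)
    (huniv : ∀ x, x ∈ V₁ ∪ V₂)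
    (hw : ∀ x y : V, x ∈ V₁ → y ∈ V₂ → x ≠ a → y ≠ a → w s(x, y) = 0)
    (h₁ : ∀ x y z : V, x ∈ V₁ → y ∈ V₁ → z ∈ V₁ →
      0 ≤ sahiE3 (prodBernoulli w) (openConnIn V₁ s x) (openConnIn V₁ s y) (openConnIn V₁ s z))
    (h₂ : ∀ x y z : V, x ∈ V₂ → y ∈ V₂ → z ∈ V₂ →
      0 ≤ sahiE3 (prodBernoulli w) (openConnIn V₂ a x) (openConnIn V₂ a y) (openConnIn V₂ a z))
    (t₁ t₂ t₃ : V) :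
    0 ≤ sahiE3 (prodBernoulli w) (openConn s t₁) (openConn s t₂) (openConn s t₃) := by
  have hU : V₁ ∪ V₂ = Set.univ := Set.eq_univ_of_forall huniv
  have hev : ∀ t : V, (openConn s t : Set (BondConfig V)) = openConnIn (V₁ ∪ V₂) s t := by
    intro t; rw [hU]; ext ω; exact mem_openConn_iff_openConnIn_univ
  rw [hev, hev, hev]
  exact incStar_openConnIn_of_cutVertex w hV ha₁ ha₂ hs hw h₁ h₂ (huniv t₁) (huniv t₂) (huniv t₃)

end IncStarCutVertex

end Summit.CriticalPhenomena.PercolationContinuityZ3.Theorems
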